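import Summits.CriticalPhenomena.SAWScalingLimit.Theorems.SAWDefectDecoherencePolygonParitySqueezeDefs
import Summits.CriticalPhenomena.SAWScalingLimit.Theorems.SAWDefectDecoherenceBoundaryClosureRGateTraceDartPhase
import Summits.CriticalPhenomena.SAWScalingLimit.Theorems.SAWDefectDecoherenceBoundaryClosureRFarReduction
import Summits.CriticalPhenomena.SAWScalingLimit.Theorems.SAWDevelopingMapInteriorFlatteningLiouvilleTransportA
import Summits.CriticalPhenomena.SAWScalingLimit.Theorems.SAWDefectDecoherenceObservableToSLEROrientationCoOrientedLattice
import HarnessLib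

/-!
# Crux `BoundaryClosureR` (stmt-CriticalPhenomena-14004), line `polygon-parity-squeeze`:
# one rigid phase per flat side (registered sub-goal `sidePhase_flat`, (A1b) of
# `stub_polygonIdentification`)

On an exact zigzag half-lattice ball `{v | n ≤ zigzagForm k v}` (any of the six forms `k`) that
does not contain the root dart `a = {u, w}`, all boundary mid-edges of the simply connected domain
`Λ` with midpoint in the concentric ball of radius `r - 4` carry ONE phase:

  `F_{5/8}(e) · |F_0(e')| = F_{5/8}(e') · |F_0(e)|`.

Proof.
* Form `0` (`zigzagForm 0 v = v.1 1`, horizontal floor): the boundary mid-edges near the centre are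
  the vertical floor darts `{(j, n-1; 1), (j, n; 0)}` of the threshold row
  (`GateMass.exists_eq_floorEdge_of_pin`); between two of them the whole floor segment has its
  midpoints in the small ball (`GateMass.smul_hexMidpoint_floorEdge_mem_ball_of_between`), so the
  up faces, the faces below and the down faces of the segment are decided by the pin, no dart of the
  segment is the root (the root midpoint is outside the big ball), and the straight gate
  `BoundaryExactness.straightGate` gives equal windings of all walks from the root to the two darts;
  the phase factorisation `LocalL1.observable_eq_phase_mul_zero_spin_of_mem_boundary`
  (`F_σ(e) = e^{-iσW} F_0(e)`, `F_0(e) = Z(a → e) ≥ 0`) finishes.  No walk to a dart: both sides `0`.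
* Forms `1 … 5`: the `60°` face rotation `σ = hexRot60` (`hexRotIso j = σ^j`, centres multiplied by
  `ζ^j`, `|ζ| = 1`) satisfies `zigzagForm k v = (σ^{j_k} v).1 1 + c_k` with
  `(j_k, c_k) = (0,0), (3,1), (2,0), (5,1), (1,0), (4,1)` (`zigzagForm_table`); the observable, the
  boundary mid-edges, simple connectivity and balls are transported along any graph automorphism
  acting by a similarity (`InteriorFlattening.Liouville.Transport.*`), which reduces form `k` on `Λ`
  to form `0` on `σ^{j_k} Λ`.

Sources: H. Duminil-Copin, S. Smirnov, Ann. of Math. 175 (2012) (arXiv:1007.0575), §3 (the winding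
of walks to the boundary is rigid).  No definition is introduced.
-/

noncomputable section

open scoped BigOperators Topology
open Filter Set Metric Complex
open Literature.Probability.LatticeModels Literature.Probability.RandomPlanarGeometry
open Literature.Probability.RandomPlanarGeometry.SAW
open Summit.CriticalPhenomena.SAWScalingLimit.Theorems.PickHalfPlane
open Summit.CriticalPhenomena.SAWScalingLimit.Theorems.ObservableToSLE.FloorRatio
  (dist_hexCenter_hexMidpoint_le)
open Summit.CriticalPhenomena.SAWScalingLimit.Theorems.ObservableToSLER.BridgeGate (hexRot60 hexRotIso
  hexRotIso_succ_apply hexRotIso_zero_apply hexCenter_hexRotIso norm_triZeta_pow)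
open Summit.CriticalPhenomena.SAWScalingLimit.Theorems.InteriorFlattening.Liouville.Transport

namespace Summit.CriticalPhenomena.SAWScalingLimit.Theorems.PolygonParitySqueeze

namespace SidePhase

/-! ### 1. Form `0`: two floor darts of one flat floor segment -/

/-- **Form `0`, ordered columns.** For a simply connected `Λ` rooted at the boundary dart `{u, w}`,
pinned to the half-lattice `{v | n ≤ v.1 1}` on `ball x r` with the root midpoint outside that ball,
and two floor darts of row `n` in columns `j ≤ j'` whose midpoints lie in `ball x (r - 4)`:
`F_{5/8}(e_j) · |F_0(e_{j'})| = F_{5/8}(e_{j'}) · |F_0(e_j)|` (straight gate between the two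
columns + phase factorisation; degenerate cases vanish on both sides).
[cite: DuminilCopinSmirnov2012, §3 (winding of walks to the boundary)] -/
theorem floor_darts_le {Λ : Finset HexVertex} (hΛ : hexDomainSimplyConnected Λ)
    {u w : HexVertex} (huw : hexGraph.Adj u w) (hu : u ∉ Λ) (hw : w ∈ Λ) {n : ℤ} {x : ℂ} {r : ℝ}
    (hpin : ∀ v : HexVertex, hexCenter v ∈ Metric.ball x r → (v ∈ Λ ↔ n ≤ v.1 1))
    (hroot : hexMidpoint s(u, w) ∉ Metric.ball x r) {j j' : ℤ} (hjj' : j ≤ j')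
    (hj : hexMidpoint s((((![j, n - 1] : Site 2)), (1 : Fin 2)), ((![j, n] : Site 2), (0 : Fin 2))) ∈
      Metric.ball x (r - 4))
    (hj' : hexMidpoint s((((![j', n - 1] : Site 2)), (1 : Fin 2)), ((![j', n] : Site 2), (0 : Fin 2))) ∈
      Metric.ball x (r - 4)) :
    hexParafermionicObservable Λ s(u, w) hexCriticalFugacity (5 / 8)
          s((((![j, n - 1] : Site 2)), (1 : Fin 2)), ((![j, n] : Site 2), (0 : Fin 2))) *
        ((‖hexParafermionicObservable Λ s(u, w) hexCriticalFugacity 0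
          s((((![j', n - 1] : Site 2)), (1 : Fin 2)), ((![j', n] : Site 2), (0 : Fin 2)))‖ : ℝ) : ℂ) =
      hexParafermionicObservable Λ s(u, w) hexCriticalFugacity (5 / 8)
          s((((![j', n - 1] : Site 2)), (1 : Fin 2)), ((![j', n] : Site 2), (0 : Fin 2))) *
        ((‖hexParafermionicObservable Λ s(u, w) hexCriticalFugacity 0
          s((((![j, n - 1] : Site 2)), (1 : Fin 2)), ((![j, n] : Site 2), (0 : Fin 2)))‖ : ℝ) : ℂ) := by
  -- every floor midpoint of the segment lies in the small ball
  have hmid : ∀ k : ℤ, j ≤ k → k ≤ j' →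
      hexMidpoint s((((![k, n - 1] : Site 2)), (1 : Fin 2)), ((![k, n] : Site 2), (0 : Fin 2))) ∈
        Metric.ball x (r - 4) := by
    intro k hk hk'
    have h1 : ((1 : ℝ) : ℂ) *
        hexMidpoint s((((![j, n - 1] : Site 2)), (1 : Fin 2)), ((![j, n] : Site 2), (0 : Fin 2))) ∈
          Metric.ball x (r - 4) := by rwa [Complex.ofReal_one, one_mul]
    have h2 : ((1 : ℝ) : ℂ) *
        hexMidpoint s((((![j', n - 1] : Site 2)), (1 : Fin 2)), ((![j', n] : Site 2), (0 : Fin 2))) ∈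
          Metric.ball x (r - 4) := by rwa [Complex.ofReal_one, one_mul]
    have h := GateMass.smul_hexMidpoint_floorEdge_mem_ball_of_between zero_le_one h1 h2 hk hk'
    rwa [Complex.ofReal_one, one_mul] at h
  -- hence every face centre within distance `1` of such a midpoint lies in the big ball
  have hball : ∀ (k : ℤ) (v : HexVertex), j ≤ k → k ≤ j' →
      dist (hexCenter v)
        (hexMidpoint s((((![k, n - 1] : Site 2)), (1 : Fin 2)), ((![k, n] : Site 2), (0 : Fin 2)))) ≤ 1 →
      hexCenter v ∈ Metric.ball x r := by
    intro k v hk hk' hd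
    have h := hmid k hk hk'
    rw [Metric.mem_ball] at h ⊢
    linarith [dist_triangle (hexCenter v)
      (hexMidpoint s((((![k, n - 1] : Site 2)), (1 : Fin 2)), ((![k, n] : Site 2), (0 : Fin 2)))) x]
  -- the segment is a flat floor of row `n`
  have hF : ∀ k : ℤ, j ≤ k → k ≤ j' → ((![k, n], 0) : HexVertex) ∈ Λ ∧
      ((![k, n - 1], 1) : HexVertex) ∉ Λ ∧ (k < j' → ((![k, n], 1) : HexVertex) ∈ Λ) := by
    intro k hk hk'
    refine ⟨?_, ?_, fun _ => ?_⟩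
    · have hb := hball k _ hk hk' ((dist_hexCenter_hexMidpoint_le (GateMass.floorEdge_mem_edgeSet k n)
        (Sym2.mem_mk_right _ _)).trans (by norm_num))
      exact (hpin _ hb).2 (by simp)
    · have hb := hball k _ hk hk' ((dist_hexCenter_hexMidpoint_le (GateMass.floorEdge_mem_edgeSet k n)
        (Sym2.mem_mk_left _ _)).trans (by norm_num))
      intro h
      have h' := (hpin _ hb).1 h
      simp at h'
    · have hb := hball k _ hk hk' (GateMass.dist_hexCenter_down_hexMidpoint_floorEdge_le k n)
      exact (hpin _ hb).2 (by simp)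
  -- no dart of the segment is the root
  have hroot' : ∀ k : ℤ, j ≤ k → k ≤ j' →
      s((((![k, n - 1] : Site 2)), (1 : Fin 2)), ((![k, n] : Site 2), (0 : Fin 2))) ≠ s(u, w) := by
    intro k hk hk' h
    apply hroot
    rw [← h]
    exact Metric.ball_subset_ball (by linarith) (hmid k hk hk')
  have ha : s(u, w) ∈ hexDomainBoundary Λ := BoundaryExactness.mk_mem_hexDomainBoundary huw hu hw
  have hbd : ∀ k : ℤ, j ≤ k → k ≤ j' →
      s((((![k, n - 1] : Site 2)), (1 : Fin 2)), ((![k, n] : Site 2), (0 : Fin 2))) ∈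
        hexDomainBoundary Λ := fun k hk hk' =>
    BoundaryExactness.mk_mem_hexDomainBoundary (GateMass.adj_floorEdge' k n) (hF k hk hk').2.1
      (hF k hk hk').1
  -- degenerate cases: no walk to one of the two darts
  by_cases hne : Nonempty (HexMidEdgeSAW Λ s(u, w)
      s((((![j, n - 1] : Site 2)), (1 : Fin 2)), ((![j, n] : Site 2), (0 : Fin 2))))
  swap
  · rw [not_nonempty_iff] at hne
    have h0 : ∀ σ : ℝ, hexParafermionicObservable Λ s(u, w) hexCriticalFugacity σ
        s((((![j, n - 1] : Site 2)), (1 : Fin 2)), ((![j, n] : Site 2), (0 : Fin 2))) = 0 := fun σ => by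
      rw [hexParafermionicObservable_def, Finset.univ_eq_empty, Finset.sum_empty]
    rw [h0, h0, norm_zero, Complex.ofReal_zero, zero_mul, mul_zero]
  by_cases hne' : Nonempty (HexMidEdgeSAW Λ s(u, w)
      s((((![j', n - 1] : Site 2)), (1 : Fin 2)), ((![j', n] : Site 2), (0 : Fin 2))))
  swap
  · rw [not_nonempty_iff] at hne'
    have h0 : ∀ σ : ℝ, hexParafermionicObservable Λ s(u, w) hexCriticalFugacity σ
        s((((![j', n - 1] : Site 2)), (1 : Fin 2)), ((![j', n] : Site 2), (0 : Fin 2))) = 0 := fun σ => by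
      rw [hexParafermionicObservable_def, Finset.univ_eq_empty, Finset.sum_empty]
    rw [h0, h0, norm_zero, Complex.ofReal_zero, zero_mul, mul_zero]
  obtain ⟨γ⟩ := hne
  obtain ⟨γ'⟩ := hne'
  -- equal windings (straight gate), equal phases
  have hW : γ'.winding = γ.winding :=
    BoundaryExactness.straightGate Λ hΛ u w huw hu hw n j j' hF hroot' j j' le_rfl hjj' hjj' le_rfl γ γ'
  rw [LocalL1.observable_eq_phase_mul_zero_spin_of_mem_boundary hΛ ha (hbd j le_rfl hjj') γ
      hexCriticalFugacity (5 / 8),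
    LocalL1.observable_eq_phase_mul_zero_spin_of_mem_boundary hΛ ha (hbd j' hjj' le_rfl) γ'
      hexCriticalFugacity (5 / 8), hW,
    GateMass.norm_obs_zero_eq_archMass, GateMass.norm_obs_zero_eq_archMass,
    hexParafermionicObservable_zero_spin, hexParafermionicObservable_zero_spin]
  ring

/-- **Form `0`.** Same, for any two boundary mid-edges `e, e'` with midpoints in `ball x (r - 4)`:
both are floor darts of the threshold row (their endpoints are within `1/2` of the midpoint, hence
pinned), and the ordered case applies one way or the other.
[cite: DuminilCopinSmirnov2012, §3 (winding of walks to the boundary)] -/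
theorem form_zero {Λ : Finset HexVertex} (hΛ : hexDomainSimplyConnected Λ)
    {u w : HexVertex} (huw : hexGraph.Adj u w) (hu : u ∉ Λ) (hw : w ∈ Λ) {n : ℤ} {x : ℂ} {r : ℝ}
    (hpin : ∀ v : HexVertex, hexCenter v ∈ Metric.ball x r → (v ∈ Λ ↔ n ≤ v.1 1))
    (hroot : hexMidpoint s(u, w) ∉ Metric.ball x r) {e e' : Sym2 HexVertex}
    (he : e ∈ hexDomainBoundary Λ) (he' : e' ∈ hexDomainBoundary Λ)
    (heb : hexMidpoint e ∈ Metric.ball x (r - 4)) (heb' : hexMidpoint e' ∈ Metric.ball x (r - 4)) :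
    hexParafermionicObservable Λ s(u, w) hexCriticalFugacity (5 / 8) e *
        ((‖hexParafermionicObservable Λ s(u, w) hexCriticalFugacity 0 e'‖ : ℝ) : ℂ) =
      hexParafermionicObservable Λ s(u, w) hexCriticalFugacity (5 / 8) e' *
        ((‖hexParafermionicObservable Λ s(u, w) hexCriticalFugacity 0 e‖ : ℝ) : ℂ) := by
  have hP : ∀ {d : Sym2 HexVertex}, d ∈ hexDomainBoundary Λ → hexMidpoint d ∈ Metric.ball x (r - 4) →
      ∀ v ∈ d, hexCenter v ∈ Metric.ball x r := by
    intro d hd hdb v hv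
    have h1 := dist_hexCenter_hexMidpoint_le hd.1 hv
    rw [Metric.mem_ball] at hdb ⊢
    linarith [dist_triangle (hexCenter v) (hexMidpoint d) x]
  obtain ⟨j, rfl⟩ := GateMass.exists_eq_floorEdge_of_pin hpin he (hP he heb)
  obtain ⟨j', rfl⟩ := GateMass.exists_eq_floorEdge_of_pin hpin he' (hP he' heb')
  rcases le_total j j' with h | h
  · exact floor_darts_le hΛ huw hu hw hpin hroot h heb heb'
  · exact (floor_darts_le hΛ huw hu hw hpin hroot h heb' heb).symm

/-! ### 2. The rotation table of the six forms and the transport to form `0` -/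

/-- **Rotation table of the six zigzag forms**: with `σ = hexRot60` (`hexRotIso j = σ^j`),
`zigzagForm 0 = row ∘ σ^0`, `zigzagForm 4 = row ∘ σ^1`, `zigzagForm 2 = row ∘ σ^2`,
`zigzagForm 1 = row ∘ σ^3 + 1`, `zigzagForm 5 = row ∘ σ^4 + 1`, `zigzagForm 3 = row ∘ σ^5 + 1`
(`row v = v.1 1`). [folklore] -/
theorem zigzagForm_table (v : HexVertex) :
    zigzagForm 0 v = (hexRotIso 0 v).1 1 ∧ zigzagForm 4 v = (hexRotIso 1 v).1 1 ∧
    zigzagForm 2 v = (hexRotIso 2 v).1 1 ∧ zigzagForm 1 v = (hexRotIso 3 v).1 1 + 1 ∧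
    zigzagForm 5 v = (hexRotIso 4 v).1 1 + 1 ∧ zigzagForm 3 v = (hexRotIso 5 v).1 1 + 1 := by
  obtain ⟨y, t⟩ := v
  fin_cases t <;> refine ⟨?_, ?_, ?_, ?_, ?_, ?_⟩ <;>
    simp [zigzagForm, hexRotIso_succ_apply, hexRot60] <;> ring

/-- Every zigzag form is the row function after a lattice rotation, up to an integer shift:
`zigzagForm k v = (σ^j v).1 1 + c` for some `j`, `c`. [folklore] -/
theorem exists_rot_of_form (k : Fin 6) :
    ∃ (j : ℕ) (c : ℤ), ∀ v : HexVertex, zigzagForm k v = (hexRotIso j v).1 1 + c := by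
  fin_cases k
  · exact ⟨0, 0, fun v => (zigzagForm_table v).1.trans (add_zero _).symm⟩
  · exact ⟨3, 1, fun v => (zigzagForm_table v).2.2.2.1⟩
  · exact ⟨2, 0, fun v => (zigzagForm_table v).2.2.1.trans (add_zero _).symm⟩
  · exact ⟨5, 1, fun v => (zigzagForm_table v).2.2.2.2.2⟩
  · exact ⟨1, 0, fun v => (zigzagForm_table v).2.1.trans (add_zero _).symm⟩
  · exact ⟨4, 1, fun v => (zigzagForm_table v).2.2.2.2.1⟩

/-- **Transport to form `0`.** If a graph automorphism `T` of `ℍ` acts on the face centres by a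
rotation `z ↦ α z` (`‖α‖ = 1`) and straightens the form `k`, `zigzagForm k v = (T v).1 1 + c`, then
the one-phase identity for form `k` on `Λ` follows from form `0` on `T Λ` (the observable, boundary
mid-edges, simple connectivity, midpoints and balls are transported along `T`).
[cite: DuminilCopinSmirnov2012, §3 (winding of walks to the boundary)] -/
theorem of_transport (T : hexGraph ≃g hexGraph) {α : ℂ} (hα : ‖α‖ = 1)
    (hT : ∀ f : HexVertex, hexCenter (T f) = α * hexCenter f + 0) {k : Fin 6} {c : ℤ}
    (hk : ∀ v : HexVertex, zigzagForm k v = (T v).1 1 + c)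
    {Λ : Finset HexVertex} (hΛ : hexDomainSimplyConnected Λ) {u w : HexVertex}
    (huw : hexGraph.Adj u w) (hu : u ∉ Λ) (hw : w ∈ Λ) {n : ℤ} {x : ℂ} {r : ℝ}
    (hpin : ∀ v : HexVertex, hexCenter v ∈ Metric.ball x r → (v ∈ Λ ↔ n ≤ zigzagForm k v))
    (hroot : hexMidpoint s(u, w) ∉ Metric.ball x r) {e e' : Sym2 HexVertex}
    (he : e ∈ hexDomainBoundary Λ) (he' : e' ∈ hexDomainBoundary Λ)
    (heb : hexMidpoint e ∈ Metric.ball x (r - 4)) (heb' : hexMidpoint e' ∈ Metric.ball x (r - 4)) :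
    hexParafermionicObservable Λ s(u, w) hexCriticalFugacity (5 / 8) e *
        ((‖hexParafermionicObservable Λ s(u, w) hexCriticalFugacity 0 e'‖ : ℝ) : ℂ) =
      hexParafermionicObservable Λ s(u, w) hexCriticalFugacity (5 / 8) e' *
        ((‖hexParafermionicObservable Λ s(u, w) hexCriticalFugacity 0 e‖ : ℝ) : ℂ) := by
  have hα0 : α ≠ 0 := norm_ne_zero_iff.1 (by rw [hα]; exact one_ne_zero)
  -- `z ↦ α z` is an isometry
  have hdist : ∀ z y : ℂ, dist (α * z + 0) (α * y) = dist z y := fun z y => by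
    rw [add_zero, Complex.dist_eq, ← mul_sub, norm_mul, hα, one_mul, Complex.dist_eq]
  -- the image domain is pinned to the half-lattice of form `0`, threshold `n - c`, on the rotated ball
  have hpin' : ∀ v : HexVertex, hexCenter v ∈ Metric.ball (α * x) r →
      (v ∈ Λ.image T ↔ n - c ≤ v.1 1) := by
    intro v hv
    have hc : hexCenter v = α * hexCenter (T.symm v) + 0 := by rw [← hT, RelIso.apply_symm_apply]
    rw [hc, Metric.mem_ball, hdist, ← Metric.mem_ball] at hv
    rw [mem_image_iff T, hpin _ hv, hk, RelIso.apply_symm_apply, sub_le_iff_le_add]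
  have hroot_eq : s(T u, T w) = Sym2.map T s(u, w) := (Sym2.map_mk T u w).symm
  have hroot' : hexMidpoint s(T u, T w) ∉ Metric.ball (α * x) r := by
    intro h
    rw [hroot_eq, hexMidpoint_map T hT, Metric.mem_ball, hdist, ← Metric.mem_ball] at h
    exact hroot h
  have hbT : ∀ {d : Sym2 HexVertex}, hexMidpoint d ∈ Metric.ball x (r - 4) →
      hexMidpoint (d.map T) ∈ Metric.ball (α * x) (r - 4) := by
    intro d hd
    rwa [hexMidpoint_map T hT, Metric.mem_ball, hdist, ← Metric.mem_ball]
  have key := form_zero ((hexDomainSimplyConnected_image_iff T Λ).2 hΛ) (T.map_rel_iff.2 huw)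
    (fun h => hu (T.injective.mem_finset_image.1 h)) (T.injective.mem_finset_image.2 hw) hpin' hroot'
    ((map_mem_hexDomainBoundary_iff T Λ e).2 he) ((map_mem_hexDomainBoundary_iff T Λ e').2 he')
    (hbT heb) (hbT heb')
  rw [hroot_eq] at key
  simpa only [hexParafermionicObservable_image T hα0 hT] using key

end SidePhase

/-! ### 3. The registered sub-goal -/

/-- **REGISTERED SUB-GOAL `sidePhase_flat` ((A1b) of `stub_polygonIdentification`, line
`polygon-parity-squeeze`, crux stmt-CriticalPhenomena-14004): one rigid phase per flat side.**
For a simply connected `Λ` rooted at the boundary dart `{u, w}` (`u ∉ Λ ∋ w`), pinned on `ball x r`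
to an exact zigzag half-lattice `{v | n ≤ zigzagForm k v}` of any of the six forms, with the root
midpoint outside that ball, any two boundary mid-edges `e, e'` with midpoints in `ball x (r - 4)`
satisfy `F_{5/8}(e) · |F_0(e')| = F_{5/8}(e') · |F_0(e)|` (form `0`: the straight gate and the
phase factorisation; forms `1 … 5`: the lattice rotation `hexRotIso`).
[cite: DuminilCopinSmirnov2012, §3 (winding of walks to the boundary)] -/
theorem sidePhase_flat : ∀ (Λ : Finset HexVertex), hexDomainSimplyConnected Λ → ∀ (u w : HexVertex), hexGraph.Adj u w → u ∉ Λ → w ∈ Λ → ∀ (k : Fin 6) (n : ℤ) (x : ℂ) (r : ℝ), (∀ v : HexVertex, hexCenter v ∈ Metric.ball x r → (v ∈ Λ ↔ n ≤ zigzagForm k v)) → hexMidpoint s(u, w) ∉ Metric.ball x r → ∀ e ∈ hexDomainBoundary Λ, ∀ e' ∈ hexDomainBoundary Λ, hexMidpoint e ∈ Metric.ball x (r - 4) → hexMidpoint e' ∈ Metric.ball x (r - 4) → hexParafermionicObservable Λ s(u, w) hexCriticalFugacity (5 / 8) e * ((‖hexParafermionicObservable Λ s(u, w) hexCriticalFugacity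 0 e'‖ : ℝ) : ℂ) = hexParafermionicObservable Λ s(u, w) hexCriticalFugacity (5 / 8) e' * ((‖hexParafermionicObservable Λ s(u, w) hexCriticalFugacity 0 e‖ : ℝ) : ℂ) := by
  intro Λ hΛ u w huw hu hw k n x r hpin hroot e he e' he' heb heb'
  obtain ⟨j, c, hk⟩ := SidePhase.exists_rot_of_form k
  exact SidePhase.of_transport (hexRotIso j) (norm_triZeta_pow j)
    (fun f => by rw [hexCenter_hexRotIso, add_zero]) hk hΛ huw hu hw hpin hroot he he' heb heb'

end Summit.CriticalPhenomena.SAWScalingLimit.Theorems.PolygonParitySqueeze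

end
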